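import Summits.BirchSwinnertonDyer.BirchSwinnertonDyer.Theorems.SignedLowerHalvesSprungLowerDivisibilityAtThreeKatoSporadicLedgerIota
import Summits.BirchSwinnertonDyer.BirchSwinnertonDyer.Theorems.SignedLowerHalvesSprungLowerDivisibilityAtThreeKatoSporadicLedgerKato
import Summits.BirchSwinnertonDyer.Rank1Residual.Supersingular.X8PrintDischarge
import HarnessLib

/-!
# Crux `SprungLowerDivisibilityAtThree` (item stmt-BirchSwinnertonDyer-19875), line `chromatic-common-zeros`, skeleton v8:
# the sporadic ledger of stub K_spor on an `ι`-ORBIT with Kato's Thm. 13.4 CONSUMED (print-keyed, w2 g7 p649616) —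
# (i) a Selmer-free TEST of the typed stub: on a sporadic `ι`-pair the typed K_spor forces LOCAL-INDEX SYMMETRY
# `j(𝔭) = j(ι𝔭)` of the two Coleman maps; (ii) the ORBIT WINDOW `m(𝔭) ≤ k(𝔭) + k(ι𝔭)` modulo the cokernel bound F-α only

Cell `bsd-ssimc` (host), width seat `cruxlead-stmt-BirchSwinnertonDyer-19875-w3` (gen 6) under the 19875 LEAD; `--supports`
stmt-BirchSwinnertonDyer-19875 `--as helper`; theorems only; closes NO item. Fourth piece of the socket-α currency
(`…KatoSporadicLedger` w2 g7 · `…LedgerJoint` · `…LedgerDoor` · `…LedgerIota` · w2 g7's `…LedgerX8`, `…LedgerKato`).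
CONDITIONAL on the named facts `h134C = Kato2004.thm13_4_lengthAt_fineSelmerDualContra_le_of_isEulerSystemClass` (Kato 2004
Thm. 13.4, print-exact key) and `hSerre = serre_adicImage_contains_congruenceSubgroup`, exactly as p649616. HONEST FRAMING:
structure and a falsifiability handle for the open stub; K_spor, K1, leaf X8 and BSD are NOT proved by anything here.

Notation at a height-one `𝔭 ∌ p` of `Λ`, `ι𝔭 = PrimeSpectrum.comap ι 𝔭`, joint ♯/♭ package `I, Cs, Cf` (`Cs.Z = Cf.Z`), `γ`-keyed
fine dual datum `Y` (and an auxiliary `γ⁻¹`-keyed `FB`, the print-exact object): `k = ℓ(I.H ⧸ Z)`, `c^• = ℓ(Λ ⧸ range Col^•)`,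
`j = min(c♯, c♭)`, `m = min(ℓ Λ/(Gs), ℓ Λ/(Gf))`, `x = ℓ Y.X`.
* §1 `localIndex_eq_comap_invol_of_katoFineLowerAt_pair`: the TYPED stub body at `𝔭` and at `ι𝔭` ⟹ `k(𝔭) = k(ι𝔭)` (w2 g7,
  `zeta_comap_invol_eq_zeta_of_katoFineLowerAt_pair`) ⟹ **`j(𝔭) = j(ι𝔭)`** (`…LedgerIota`: `k + j` is `ι`-symmetric). The
  conclusion mentions NO Selmer group: it is a statement about the two Coleman maps on `𝐇¹` alone — a necessary condition for
  the typed K_spor on every sporadic `ι`-pair, hence a target for the disprover (index symmetry is «believed, not in print»,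
  STUB-PLAN §0bis).
* §2 `min_lengthAt_quotient_span_le_zeta_add_zeta_comap_invol_of_thm13_4`: the orbit window with Kato's bound DISCHARGED —
  F-α at `𝔭` (`j(𝔭) ≤ x(𝔭)`, displayed) ⟹ `m(𝔭) ≤ k(𝔭) + k(ι𝔭)`; hence `no_invisible_commonZero`: a common zero of the two
  normalised colours at a sporadic `𝔭` (`Gs, Gf ∈ 𝔭`) forces `1 ≤ k(𝔭) + k(ι𝔭)` — Kato's zeta index SEES every sporadic
  common zero on its `ι`-orbit (modulo F-α). §3: the X8 forms (¬CM, `E[3]` irreducible, both colours non-zero discharged).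

References: [Kato2004Asterisque] Conj. 12.10 (p. 224), Thm. 12.6 (p. 222), Thm. 13.4 (p. 226), §17.13 (p. 280); [Sprung2012] Def. 6.1,
§7.1, Thm. 7.14 (3); [Sprung2017] Thm. 4.13, Cor. 4.14; [GreenbergLNM1716] §1; [Wingberg1989] Cor. 2.5 / [Matar2020] Thm. 1.1;
[SerreAbelianLadic1968] IV-11; tree: `…KatoSporadicLedgerKato` (p649616), `…KatoSporadicLedgerIota`, `…KatoSporadicLedgerJoint`
(p648952), `Rank1Residual/Supersingular/X8PrintDischarge` (`ClassX8.not_hasCM`).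
-/

set_option linter.dupNamespace false
set_option autoImplicit false

noncomputable section

open scoped Classical NumberField MatrixGroups ModularForm

open NumberField IsDedekindDomain CongruenceSubgroup WeierstrassCurve Field
  Literature.NumberTheory.EllipticCurves Literature.NumberTheory.EllipticCurves.ModularForms
  Literature.NumberTheory.EllipticCurves.ZpExtension Literature.NumberTheory.EllipticCurves.Sprung2017
  Literature.NumberTheory.EllipticCurves.Sprung2012 Literature.NumberTheory.EllipticCurves.Rank1Residual
  Literature.NumberTheory.EllipticCurves.IwasawaAlgebra Literature.NumberTheory.EllipticCurves.Kato2004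
  Literature.NumberTheory.EllipticCurves.Module
  Summit.BirchSwinnertonDyer.BirchSwinnertonDyer.Theorems
  Summit.BirchSwinnertonDyer.BirchSwinnertonDyer.Theorems.SmallImageSignedMuDefect
  Summit.BirchSwinnertonDyer.Rank1Residual.Supersingular

namespace Summit.BirchSwinnertonDyer.BirchSwinnertonDyer.Theorems.ChromaticCommonZeros

section Package

variable (W : WeierstrassCurve ℚ) [W.IsElliptic] (p : ℕ) [Fact p.Prime]
  [ContinuousSMul ℤ_[p] (W.tateModule p)] [Module.Free ℤ_[p] (W.tateModule p)]
  [Module.Finite ℤ_[p] (W.tateModule p)]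
  {N : ℕ} {f : CuspForm (Gamma0 N) 2} {ϖ : ℚ} {κ : ZpExtension ℚ p} {γ : absoluteGaloisGroup ℚ}
  {E : Type} [Field E] [Algebra ℚ E] {ι : AlgebraicClosure ℚ →ₐ[ℚ] AlgebraicClosure E} {ap : ℤ}
  {g : absoluteGaloisGroup E} {c : ℕ → localPoints W E} {I : IwasawaH1Data W p κ γ}

/-! ### §1 The Selmer-free test: the typed stub on an `ι`-orbit forces local-index symmetry -/

/-- **THE TYPED STUB ON A SPORADIC `ι`-PAIR FORCES LOCAL-INDEX SYMMETRY `j(𝔭) = j(ι𝔭)`.** Joint ♯/♭ package with the same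
zeta line, `(L♯, L♭)` `ι`-stable (displayed; automatic on X8), both colours non-zero and normalised, `ϖ ≠ 0`, `E[p]`
irreducible, `p ≠ 2`, `¬CM`; a `γ`-keyed `Y` and a `γ⁻¹`-keyed `FB`; a height-one `𝔭 ∌ p`. IF the typed body of
`stub_katoFineLowerSporadic` holds at `𝔭` AND at `ι𝔭` for `Y`, THEN `min_• ℓ_𝔭(Λ/range Col^•) = min_• ℓ_{ι𝔭}(Λ/range Col^•)`.
Chain: typed body on the orbit ⟹ `k(𝔭) = k(ι𝔭)` (Kato Thm. 13.4 print-keyed, w2 g7) ⟹ `j(𝔭) = j(ι𝔭)` (`k + j` is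
`ι`-symmetric, `…LedgerIota`). The conclusion is about the two COLEMAN MAPS on `𝐇¹` only — a necessary condition for the
typed K_spor that a disprover can attack without any Selmer group. CONDITIONAL on `h134C`, `hSerre`.
[cite: Kato2004Asterisque, Conj. 12.10 (p. 224), Thm. 13.4 (p. 226)] [cite: Sprung2012, §7.1, Thm. 7.14 (3)] [cite: GreenbergLNM1716, §1] -/
theorem localIndex_eq_comap_invol_of_katoFineLowerAt_pair
    (h134C : thm13_4_lengthAt_fineSelmerDualContra_le_of_isEulerSystemClass)
    (hSerre : serre_adicImage_contains_congruenceSubgroup)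
    (Cs : SharpFlatColemanKatoData W p f ϖ κ γ ι ap g c Chroma.sharp I)
    (Cf : SharpFlatColemanKatoData W p f ϖ κ γ ι ap g c Chroma.flat I) (hZ : Cs.Z = Cf.Z)
    (hp : p ≠ 2) (hκ : κ.IsCyclotomic) (hγ : κ.IsTopGenerator γ) (hCM : ¬ W.HasCM)
    (hirr : W.HasIrreducibleModPGaloisRep p) (hϖ : ϖ ≠ 0) {Lsharp Lflat Gs Gf : IwasawaAlgebra p}
    (hSP : IsSprungPair f p ap Lsharp Lflat) (hs0 : Lsharp ≠ 0) (hf0 : Lflat ≠ 0)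
    (hGs : iwasawaToPowerSeries p Gs =
      PowerSeries.C ((ϖ : ℚ) : ℚ_[p]) * iwasawaToPowerSeries p (chromaticL Chroma.sharp Lsharp Lflat))
    (hGf : iwasawaToPowerSeries p Gf =
      PowerSeries.C ((ϖ : ℚ) : ℚ_[p]) * iwasawaToPowerSeries p (chromaticL Chroma.flat Lsharp Lflat))
    (hGs0 : Gs ≠ 0)
    (hJ : ∀ x ∈ Ideal.span ({Lsharp, Lflat} : Set (IwasawaAlgebra p)),
      invol p x ∈ Ideal.span ({Lsharp, Lflat} : Set (IwasawaAlgebra p)))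
    (Y : W.FineSelmerDualData κ γ) (FB : W.FineSelmerDualData κ γ⁻¹)
    (𝔭 : PrimeSpectrum (IwasawaAlgebra p)) (h𝔭 : 𝔭.asIdeal.height = 1)
    (hp𝔭 : (p : IwasawaAlgebra p) ∉ 𝔭.asIdeal)
    (hstub : Module.lengthAt (IwasawaAlgebra p) (I.H ⧸ Cs.Z) 𝔭 ≤ Module.lengthAt (IwasawaAlgebra p) Y.X 𝔭)
    (hstub' : Module.lengthAt (IwasawaAlgebra p) (I.H ⧸ Cs.Z) (PrimeSpectrum.comap (invol p).toRingHom 𝔭) ≤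
      Module.lengthAt (IwasawaAlgebra p) Y.X (PrimeSpectrum.comap (invol p).toRingHom 𝔭)) :
    min (Module.lengthAt (IwasawaAlgebra p) (IwasawaAlgebra p ⧸ LinearMap.range Cs.colMap) 𝔭)
        (Module.lengthAt (IwasawaAlgebra p) (IwasawaAlgebra p ⧸ LinearMap.range Cf.colMap) 𝔭) =
      min (Module.lengthAt (IwasawaAlgebra p) (IwasawaAlgebra p ⧸ LinearMap.range Cs.colMap)
          (PrimeSpectrum.comap (invol p).toRingHom 𝔭))
        (Module.lengthAt (IwasawaAlgebra p) (IwasawaAlgebra p ⧸ LinearMap.range Cf.colMap)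
          (PrimeSpectrum.comap (invol p).toRingHom 𝔭)) := by
  have hcs : chromaticL Chroma.sharp Lsharp Lflat ≠ 0 := by rwa [chromaticL_sharp]
  have hk := Cs.zeta_comap_invol_eq_zeta_of_katoFineLowerAt_pair W p h134C hSerre hp hκ hγ hCM hirr hSP hcs hGs hGs0 Y FB
    𝔭 h𝔭 hp𝔭 hstub hstub'
  exact (zeta_eq_comap_invol_iff_localIndex_eq W p Cs Cf hZ hirr hϖ hSP hs0 hf0 hGs hGf hGs0 hJ 𝔭 h𝔭 hp𝔭).mp hk

/-! ### §2 The orbit window with Kato's bound consumed -/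

/-- **THE ORBIT WINDOW, Kato's bound DISCHARGED:** joint package at a height-one `𝔭 ∌ p`, both colours non-zero and
normalised, `E[p]` irreducible, `p ≠ 2`, `¬CM`, `γ`-keyed `Y`, `γ⁻¹`-keyed `FB`; DISPLAYED only the cokernel bound F-α at
`𝔭` (`j(𝔭) ≤ x(𝔭)`). THEN `m(𝔭) ≤ k(𝔭) + k(ι𝔭)` — Kato's Thm. 13.4 for `FB` at `ι𝔭`, read back to `Y` at `𝔭`
(`fine_comap_invol_le_zeta_of_thm13_4`, w2 g7), feeds `min_lengthAt_quotient_span_le_zeta_add_zeta_comap_invol`.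
CONDITIONAL on `h134C`, `hSerre`. [cite: Kato2004Asterisque, Thm. 13.4 (p. 226), (17.13.1) (p. 280)] [cite: Sprung2012, §7.1, Props. 7.3/7.6]
[cite: Wingberg1989, Cor. 2.5] [cite: Matar2020, Thm. 1.1] -/
theorem min_lengthAt_quotient_span_le_zeta_add_zeta_comap_invol_of_thm13_4
    (h134C : thm13_4_lengthAt_fineSelmerDualContra_le_of_isEulerSystemClass)
    (hSerre : serre_adicImage_contains_congruenceSubgroup)
    (Cs : SharpFlatColemanKatoData W p f ϖ κ γ ι ap g c Chroma.sharp I)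
    (Cf : SharpFlatColemanKatoData W p f ϖ κ γ ι ap g c Chroma.flat I) (hZ : Cs.Z = Cf.Z)
    (hp : p ≠ 2) (hκ : κ.IsCyclotomic) (hγ : κ.IsTopGenerator γ) (hCM : ¬ W.HasCM)
    (hirr : W.HasIrreducibleModPGaloisRep p) {Lsharp Lflat Gs Gf : IwasawaAlgebra p}
    (hSP : IsSprungPair f p ap Lsharp Lflat) (hs : chromaticL Chroma.sharp Lsharp Lflat ≠ 0)
    (hf : chromaticL Chroma.flat Lsharp Lflat ≠ 0)
    (hGs : iwasawaToPowerSeries p Gs =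
      PowerSeries.C ((ϖ : ℚ) : ℚ_[p]) * iwasawaToPowerSeries p (chromaticL Chroma.sharp Lsharp Lflat))
    (hGf : iwasawaToPowerSeries p Gf =
      PowerSeries.C ((ϖ : ℚ) : ℚ_[p]) * iwasawaToPowerSeries p (chromaticL Chroma.flat Lsharp Lflat))
    (hGs0 : Gs ≠ 0) (Y : W.FineSelmerDualData κ γ) (FB : W.FineSelmerDualData κ γ⁻¹)
    (𝔭 : PrimeSpectrum (IwasawaAlgebra p)) (h𝔭 : 𝔭.asIdeal.height = 1)
    (hp𝔭 : (p : IwasawaAlgebra p) ∉ 𝔭.asIdeal)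
    (hFα : min (Module.lengthAt (IwasawaAlgebra p) (IwasawaAlgebra p ⧸ LinearMap.range Cs.colMap) 𝔭)
        (Module.lengthAt (IwasawaAlgebra p) (IwasawaAlgebra p ⧸ LinearMap.range Cf.colMap) 𝔭) ≤
      Module.lengthAt (IwasawaAlgebra p) Y.X 𝔭) :
    min (Module.lengthAt (IwasawaAlgebra p) (IwasawaAlgebra p ⧸ Ideal.span {Gs}) 𝔭)
        (Module.lengthAt (IwasawaAlgebra p) (IwasawaAlgebra p ⧸ Ideal.span {Gf}) 𝔭) ≤
      Module.lengthAt (IwasawaAlgebra p) (I.H ⧸ Cs.Z) 𝔭 +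
        Module.lengthAt (IwasawaAlgebra p) (I.H ⧸ Cs.Z) (PrimeSpectrum.comap (invol p).toRingHom 𝔭) := by
  -- Kato's bound at `ι𝔭`, read back to `𝔭` through `ιι𝔭 = 𝔭`
  obtain ⟨h𝔭', hp𝔭'⟩ := comap_invol_heightOne_not_mem 𝔭 h𝔭 hp𝔭
  have hKato := Cs.fine_comap_invol_le_zeta_of_thm13_4 W p h134C hSerre hp hκ hγ hCM hirr hSP hs hGs hGs0 Y FB
    (PrimeSpectrum.comap (invol p).toRingHom 𝔭) h𝔭' hp𝔭'
  rw [Kato2004.comap_invol_comap_invol] at hKato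
  exact min_lengthAt_quotient_span_le_zeta_add_zeta_comap_invol W p Cs Cf hZ hirr hSP hs hf hGs hGf Y 𝔭 h𝔭 hFα hKato

/-- **NO SPORADIC COMMON ZERO IS INVISIBLE TO KATO'S ZETA INDEX ON ITS `ι`-ORBIT (modulo F-α).** In the situation of
`min_lengthAt_quotient_span_le_zeta_add_zeta_comap_invol_of_thm13_4`: if BOTH normalised colours vanish at `𝔭`
(`Gs, Gf ∈ 𝔭` — a common zero), then `1 ≤ k(𝔭) + k(ι𝔭)`: the zeta module `Z` is a PROPER submodule of `𝐇¹` locally at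
`𝔭` or at `ι𝔭`. Contrapositive: where Kato's zeta index vanishes on the whole `ι`-orbit, the cokernel bound F-α alone
EXCLUDES a common zero there (and K_spor is vacuous). CONDITIONAL on `h134C`, `hSerre`.
[cite: Kato2004Asterisque, Conj. 12.10 (p. 224), Thm. 13.4 (p. 226)] [cite: Sprung2015, Conj. 5.6] [cite: KuriharaPollack2007, Problem 3.2] -/
theorem one_le_zeta_add_zeta_comap_invol_of_commonZero_of_thm13_4
    (h134C : thm13_4_lengthAt_fineSelmerDualContra_le_of_isEulerSystemClass)
    (hSerre : serre_adicImage_contains_congruenceSubgroup)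
    (Cs : SharpFlatColemanKatoData W p f ϖ κ γ ι ap g c Chroma.sharp I)
    (Cf : SharpFlatColemanKatoData W p f ϖ κ γ ι ap g c Chroma.flat I) (hZ : Cs.Z = Cf.Z)
    (hp : p ≠ 2) (hκ : κ.IsCyclotomic) (hγ : κ.IsTopGenerator γ) (hCM : ¬ W.HasCM)
    (hirr : W.HasIrreducibleModPGaloisRep p) {Lsharp Lflat Gs Gf : IwasawaAlgebra p}
    (hSP : IsSprungPair f p ap Lsharp Lflat) (hs : chromaticL Chroma.sharp Lsharp Lflat ≠ 0)
    (hf : chromaticL Chroma.flat Lsharp Lflat ≠ 0)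
    (hGs : iwasawaToPowerSeries p Gs =
      PowerSeries.C ((ϖ : ℚ) : ℚ_[p]) * iwasawaToPowerSeries p (chromaticL Chroma.sharp Lsharp Lflat))
    (hGf : iwasawaToPowerSeries p Gf =
      PowerSeries.C ((ϖ : ℚ) : ℚ_[p]) * iwasawaToPowerSeries p (chromaticL Chroma.flat Lsharp Lflat))
    (hGs0 : Gs ≠ 0) (Y : W.FineSelmerDualData κ γ) (FB : W.FineSelmerDualData κ γ⁻¹)
    (𝔭 : PrimeSpectrum (IwasawaAlgebra p)) (h𝔭 : 𝔭.asIdeal.height = 1)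
    (hp𝔭 : (p : IwasawaAlgebra p) ∉ 𝔭.asIdeal)
    (hFα : min (Module.lengthAt (IwasawaAlgebra p) (IwasawaAlgebra p ⧸ LinearMap.range Cs.colMap) 𝔭)
        (Module.lengthAt (IwasawaAlgebra p) (IwasawaAlgebra p ⧸ LinearMap.range Cf.colMap) 𝔭) ≤
      Module.lengthAt (IwasawaAlgebra p) Y.X 𝔭)
    (hGs𝔭 : Gs ∈ 𝔭.asIdeal) (hGf𝔭 : Gf ∈ 𝔭.asIdeal) :
    1 ≤ Module.lengthAt (IwasawaAlgebra p) (I.H ⧸ Cs.Z) 𝔭 +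
        Module.lengthAt (IwasawaAlgebra p) (I.H ⧸ Cs.Z) (PrimeSpectrum.comap (invol p).toRingHom 𝔭) := by
  have hw := min_lengthAt_quotient_span_le_zeta_add_zeta_comap_invol_of_thm13_4 W p h134C hSerre Cs Cf hZ hp hκ hγ hCM
    hirr hSP hs hf hGs hGf hGs0 Y FB 𝔭 h𝔭 hp𝔭 hFα
  refine le_trans (le_min ?_ ?_) hw
  · exact Order.one_le_iff_pos.mpr (pos_iff_ne_zero.mpr
      (fun h0 => (lengthAt_quotient_span_eq_zero_iff_not_mem Gs 𝔭).mp h0 hGs𝔭))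
  · exact Order.one_le_iff_pos.mpr (pos_iff_ne_zero.mpr
      (fun h0 => (lengthAt_quotient_span_eq_zero_iff_not_mem Gf 𝔭).mp h0 hGf𝔭))

end Package

/-! ### §3 Class X8: the same with `¬CM`, `E[3]` irreducible, both colours non-zero, `ι`-stability discharged -/

section X8Package

variable (W : WeierstrassCurve ℚ) [W.IsElliptic] [W.IsGloballyMinimal] (p : ℕ) [Fact p.Prime]
  [ContinuousSMul ℤ_[p] (W.tateModule p)] [Module.Free ℤ_[p] (W.tateModule p)]
  [Module.Finite ℤ_[p] (W.tateModule p)]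
  {N : ℕ} [NeZero N] {f : CuspForm (Gamma0 N) 2} {ϖ : ℚ} {κ : ZpExtension ℚ p} {γ : absoluteGaloisGroup ℚ}
  {E : Type} [Field E] [Algebra ℚ E] {ι : AlgebraicClosure ℚ →ₐ[ℚ] AlgebraicClosure E}
  {g : absoluteGaloisGroup E} {c : ℕ → localPoints W E} {I : IwasawaH1Data W p κ γ}

/-- `Gs ≠ 0` for a Néron-normalised `Gs` of a non-zero `L♯` with `ϖ ≠ 0` (private plumbing). [cite: Sprung2012, Def. 6.1] -/
private theorem normalised_ne_zero {ϖ : ℚ} (hϖ0 : ϖ ≠ 0) {L G : IwasawaAlgebra p} (hL : L ≠ 0)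
    (hG : iwasawaToPowerSeries p G = PowerSeries.C ((ϖ : ℚ) : ℚ_[p]) * iwasawaToPowerSeries p L) : G ≠ 0 := by
  intro h0
  rw [h0, map_zero, eq_comm, mul_eq_zero] at hG
  rcases hG with hC | hL'
  · have h1 : ((ϖ : ℚ) : ℚ_[p]) = 0 := by simpa using congrArg PowerSeries.constantCoeff hC
    exact hϖ0 (by exact_mod_cast h1)
  · exact hL (iwasawaToPowerSeries_injective p (by rw [hL', map_zero]))

/-- **On class X8: the typed stub on a sporadic `ι`-pair forces `j(𝔭) = j(ι𝔭)`** (input-free but for `h134C`, `hSerre`,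
and the auxiliary `γ⁻¹`-keyed datum `FB`). [cite: Kato2004Asterisque, Conj. 12.10 (p. 224), Thm. 13.4 (p. 226)]
[cite: Sprung2017, Thm. 4.13, Cor. 4.14] [cite: Sprung2012, §7.1, Thm. 7.14 (3)] -/
theorem ClassX8.localIndex_eq_comap_invol_of_katoFineLowerAt_pair
    (h134C : thm13_4_lengthAt_fineSelmerDualContra_le_of_isEulerSystemClass)
    (hSerre : serre_adicImage_contains_congruenceSubgroup) (hX : ClassX8 W p)
    (Cs : SharpFlatColemanKatoData W p f ϖ κ γ ι (W.frobeniusTrace p) g c Chroma.sharp I)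
    (Cf : SharpFlatColemanKatoData W p f ϖ κ γ ι (W.frobeniusTrace p) g c Chroma.flat I) (hZ : Cs.Z = Cf.Z)
    (hκ : κ.IsCyclotomic) (hγ : κ.IsTopGenerator γ) {Lsharp Lflat Gs Gf : IwasawaAlgebra p} (hf : IsNewformOf W f)
    (hϖ : (ϖ : ℝ) * W.realPeriodRat = plusPeriod f) (hSP : IsSprungPair f p (W.frobeniusTrace p) Lsharp Lflat)
    (hGs : iwasawaToPowerSeries p Gs =
      PowerSeries.C ((ϖ : ℚ) : ℚ_[p]) * iwasawaToPowerSeries p (chromaticL Chroma.sharp Lsharp Lflat))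
    (hGf : iwasawaToPowerSeries p Gf =
      PowerSeries.C ((ϖ : ℚ) : ℚ_[p]) * iwasawaToPowerSeries p (chromaticL Chroma.flat Lsharp Lflat))
    (Y : W.FineSelmerDualData κ γ) (FB : W.FineSelmerDualData κ γ⁻¹)
    (𝔭 : PrimeSpectrum (IwasawaAlgebra p)) (h𝔭 : 𝔭.asIdeal.height = 1)
    (hp𝔭 : (p : IwasawaAlgebra p) ∉ 𝔭.asIdeal)
    (hstub : Module.lengthAt (IwasawaAlgebra p) (I.H ⧸ Cs.Z) 𝔭 ≤ Module.lengthAt (IwasawaAlgebra p) Y.X 𝔭)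
    (hstub' : Module.lengthAt (IwasawaAlgebra p) (I.H ⧸ Cs.Z) (PrimeSpectrum.comap (invol p).toRingHom 𝔭) ≤
      Module.lengthAt (IwasawaAlgebra p) Y.X (PrimeSpectrum.comap (invol p).toRingHom 𝔭)) :
    min (Module.lengthAt (IwasawaAlgebra p) (IwasawaAlgebra p ⧸ LinearMap.range Cs.colMap) 𝔭)
        (Module.lengthAt (IwasawaAlgebra p) (IwasawaAlgebra p ⧸ LinearMap.range Cf.colMap) 𝔭) =
      min (Module.lengthAt (IwasawaAlgebra p) (IwasawaAlgebra p ⧸ LinearMap.range Cs.colMap)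
          (PrimeSpectrum.comap (invol p).toRingHom 𝔭))
        (Module.lengthAt (IwasawaAlgebra p) (IwasawaAlgebra p ⧸ LinearMap.range Cf.colMap)
          (PrimeSpectrum.comap (invol p).toRingHom 𝔭)) := by
  obtain ⟨hs0, hf0⟩ :=
    ChromaticBothColours.ClassX8.sharp_ne_zero_and_flat_ne_zero W p hX N inferInstance f Lsharp Lflat hf hSP
  have hp3 : p = 3 := hX.1
  have hp2 : p ≠ 2 := by rw [hp3]; decide
  have hϖ0 : ϖ ≠ 0 := by
    rintro rfl
    have hpos : 0 < plusPeriod f := IsNewform0.plusPeriod_pos_holds hf.1 hf.coeffField_eq_bot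
    rw [Rat.cast_zero, zero_mul] at hϖ
    exact hpos.ne hϖ
  have hGs0 : Gs ≠ 0 := normalised_ne_zero p hϖ0 hs0 (by rwa [chromaticL_sharp] at hGs)
  exact ChromaticCommonZeros.localIndex_eq_comap_invol_of_katoFineLowerAt_pair W p h134C hSerre Cs Cf hZ hp2 hκ hγ
    (ClassX8.not_hasCM W p hX)
    (ClassX8.irr' W p hX) hϖ0 hSP hs0 hf0 hGs hGf hGs0 (ClassX8.invol_mem_span_pair W p hX f Lsharp Lflat hf hSP) Y FB 𝔭
    h𝔭 hp𝔭 hstub hstub'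

/-- **On class X8: `1 ≤ k(𝔭) + k(ι𝔭)` at every sporadic common zero `𝔭` (`Gs, Gf ∈ 𝔭`, `3 ∉ 𝔭`), modulo F-α at `𝔭`**
(and `h134C`, `hSerre`, `FB`). [cite: Kato2004Asterisque, Conj. 12.10 (p. 224), Thm. 13.4 (p. 226)] [cite: Sprung2015, Conj. 5.6] -/
theorem ClassX8.one_le_zeta_add_zeta_comap_invol_of_commonZero
    (h134C : thm13_4_lengthAt_fineSelmerDualContra_le_of_isEulerSystemClass)
    (hSerre : serre_adicImage_contains_congruenceSubgroup) (hX : ClassX8 W p)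
    (Cs : SharpFlatColemanKatoData W p f ϖ κ γ ι (W.frobeniusTrace p) g c Chroma.sharp I)
    (Cf : SharpFlatColemanKatoData W p f ϖ κ γ ι (W.frobeniusTrace p) g c Chroma.flat I) (hZ : Cs.Z = Cf.Z)
    (hκ : κ.IsCyclotomic) (hγ : κ.IsTopGenerator γ) {Lsharp Lflat Gs Gf : IwasawaAlgebra p} (hf : IsNewformOf W f)
    (hϖ : (ϖ : ℝ) * W.realPeriodRat = plusPeriod f) (hSP : IsSprungPair f p (W.frobeniusTrace p) Lsharp Lflat)
    (hGs : iwasawaToPowerSeries p Gs =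
      PowerSeries.C ((ϖ : ℚ) : ℚ_[p]) * iwasawaToPowerSeries p (chromaticL Chroma.sharp Lsharp Lflat))
    (hGf : iwasawaToPowerSeries p Gf =
      PowerSeries.C ((ϖ : ℚ) : ℚ_[p]) * iwasawaToPowerSeries p (chromaticL Chroma.flat Lsharp Lflat))
    (Y : W.FineSelmerDualData κ γ) (FB : W.FineSelmerDualData κ γ⁻¹)
    (𝔭 : PrimeSpectrum (IwasawaAlgebra p)) (h𝔭 : 𝔭.asIdeal.height = 1)
    (hp𝔭 : (p : IwasawaAlgebra p) ∉ 𝔭.asIdeal)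
    (hFα : min (Module.lengthAt (IwasawaAlgebra p) (IwasawaAlgebra p ⧸ LinearMap.range Cs.colMap) 𝔭)
        (Module.lengthAt (IwasawaAlgebra p) (IwasawaAlgebra p ⧸ LinearMap.range Cf.colMap) 𝔭) ≤
      Module.lengthAt (IwasawaAlgebra p) Y.X 𝔭)
    (hGs𝔭 : Gs ∈ 𝔭.asIdeal) (hGf𝔭 : Gf ∈ 𝔭.asIdeal) :
    1 ≤ Module.lengthAt (IwasawaAlgebra p) (I.H ⧸ Cs.Z) 𝔭 +
        Module.lengthAt (IwasawaAlgebra p) (I.H ⧸ Cs.Z) (PrimeSpectrum.comap (invol p).toRingHom 𝔭) := by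
  have hp3 : p = 3 := hX.1
  have hp2 : p ≠ 2 := by rw [hp3]; decide
  have hϖ0 : ϖ ≠ 0 := by
    rintro rfl
    have hpos : 0 < plusPeriod f := IsNewform0.plusPeriod_pos_holds hf.1 hf.coeffField_eq_bot
    rw [Rat.cast_zero, zero_mul] at hϖ
    exact hpos.ne hϖ
  have hs : chromaticL Chroma.sharp Lsharp Lflat ≠ 0 :=
    ChromaticBothColours.ClassX8.chromaticL_ne_zero W p hX f Lsharp Lflat hf hSP Chroma.sharp
  have hfl : chromaticL Chroma.flat Lsharp Lflat ≠ 0 :=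
    ChromaticBothColours.ClassX8.chromaticL_ne_zero W p hX f Lsharp Lflat hf hSP Chroma.flat
  have hGs0 : Gs ≠ 0 := normalised_ne_zero p hϖ0 hs hGs
  exact one_le_zeta_add_zeta_comap_invol_of_commonZero_of_thm13_4 W p h134C hSerre Cs Cf hZ hp2 hκ hγ
    (ClassX8.not_hasCM W p hX) (ClassX8.irr' W p hX) hSP hs hfl hGs hGf hGs0 Y FB 𝔭 h𝔭 hp𝔭 hFα hGs𝔭 hGf𝔭

end X8Package

end Summit.BirchSwinnertonDyer.BirchSwinnertonDyer.Theorems.ChromaticCommonZeros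

end
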